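import Summits.BirchSwinnertonDyer.BirchSwinnertonDyer.Theorems.KolyvaginRankRigidityAtTwoRegularRefillAtRegularStep
import Summits.BirchSwinnertonDyer.BirchSwinnertonDyer.Theorems.KolyvaginRankRigidityAtTwoWalkStepRefill
import HarnessLib

/-!
# Crux U1 `KolyvaginBoundedDefectAtTwo` (stmt-BirchSwinnertonDyer-28083), LINE 17 `regular_core_rigidity` v3,
# stub S1b `stub_nearCoreExistenceAtTwo` — ONE STEP OF THE WALK, LOCAL CONSEQUENCES IV: a refill class of large local
# order

Width seat `bsd-line-krr2-p2` g14 (ONE READER on S1b); `--supports stmt-BirchSwinnertonDyer-28083` (helper). THEOREMS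
ONLY; nothing here proves S1b, U1, a rung or BSD. BSD is NOT proved.

## Setting (g13's, `…RegularRefillAtRegularStep`)
`𝓛 = 𝓕(c)`, a regular place `v ∣ ℓ ∣ c`, `S = H¹_{𝓛[v ↦ Kum_v]}` ∋ an `s`-eigenclass `z` with
`addOrderOf (loc_v z) = 2^(k−j)`, `S' = H¹_{𝓛}`, `B = loc_v(S') ⊆ 𝒯_v`, `X = loc_v(H¹_{𝓛[v ↦ ⊤]})` isotropic.
* abstract (`section SignBricks`: a symmetric non-degenerate pairing `b`, `H_f + H_tr = L`, `H_tr` isotropic):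
  `eq_zero_of_apply_line_eq_zero` (a `t ∈ H_tr` killing `c_s` and `e₀`, where `H_f ⊆ ℤc_s + ℤe₀`, is `0`) and
  `exists_mem_natCard_map_le_mul_addOrderOf` (if `2^j · loc(S')` kills `c_s` then some `r ∈ S'` has
  `#loc(S') ≤ #(H_tr ∩ ker 2^j) · addOrderOf (loc r)`: `2^j · loc(S')` sits in the CYCLIC group `ann_{H_tr}(c_s) ↪ ZMod n`);
* **`exists_refill_class`** — some `r ∈ S'` has `#B ≤ 2·4^j · addOrderOf (loc_v r)` (`#(𝒯_v ∩ ker 2^j) ≤ #(Kum_v ∩ ker 2^j)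
  ≤ 2·4^j` by `natCard_inf_ker_le_of_pair`, p685157, and `natCard_kummer_inf_ker_le`). With the cut and refill laws
  (`…WalkStepLocal`, `…WalkStepRefill`): `#B ≥ 4^k/(2^(4j+4) · #loc_v(S))`, so at a pure-sign step the refill class
  has local order `≥ 2^k / O_j(1)` — Mazur–Rubin's Prop. 4.1.5 mechanism at `p = 2` along regular primes.
References (locators only; no cited FACT is declared): [cite: MazurRubin2004, §4.1, Prop. 4.1.5]
[cite: Jetchev2008, Lemma 5.2] [cite: Howard2004HeegnerKolyvagin, Thm. 2.1.11].
Design: no definitions; `K : Type`; axioms `propext`, `Classical.choice`, `Quot.sound`.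
-/

set_option autoImplicit false
-- the Theorems namespace of this sub repeats the summit name by design (D-0017 nested layout)
set_option linter.dupNamespace false

noncomputable section

open scoped Classical
open Function NumberField IsDedekindDomain WeierstrassCurve Field
open Literature.NumberTheory.EllipticCurves Literature.NumberTheory.EllipticCurves.Jetchev2008
open Literature.NumberTheory.GaloisRepresentations Literature.NumberTheory.GaloisCohomology
open Literature.NumberTheory.GaloisRepresentations.DiscreteGaloisModule (localTatePairingZMod tateDual
  transverseSubgroup SelmerStructure)
open Literature.NumberTheory.Automorphic
open Summit.BirchSwinnertonDyer.Rank1Residual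
open Summit.BirchSwinnertonDyer.Rank1Residual.JET.RingClassTransverse
open Summit.BirchSwinnertonDyer.Rank1Residual.JET.SelmerVocabulary
open Summit.BirchSwinnertonDyer.Rank1Residual.X11b.Relaxation (invWeilPairing invWeilPairing_apply
  invWeilPairing_eq_zero_of_mem)
open Summit.BirchSwinnertonDyer.BirchSwinnertonDyer.Theorems.KolyvaginLowerBoundAtTwo
open Summit.BirchSwinnertonDyer.Rank1Residual.JET.Section6 (card_eq_card_inf_ker_mul_card_map card_map_mul_card_map_le)

namespace Summit.BirchSwinnertonDyer.BirchSwinnertonDyer.Theorems.KolyvaginAtTwo.RegularRefill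

variable {K : Type} [Field K] [NumberField K] (W : WeierstrassCurve ℚ) [W.IsElliptic] [W.IsGloballyMinimal]
  (k : ℕ)
  (e : geomTorsion (W.baseChange K) ((2 ^ k : ℕ) : ℤ) → geomTorsion (W.baseChange K) ((2 ^ k : ℕ) : ℤ) →
    AlgebraicClosure K)
  (hμ : ∀ S T, e S T ^ (2 ^ k) = 1)
  (hadd₁ : ∀ S₁ S₂ T, e (S₁ + S₂) T = e S₁ T * e S₂ T)
  (hadd₂ : ∀ S T₁ T₂, e S (T₁ + T₂) = e S T₁ * e S T₂)
  (hgal : ∀ (g : absoluteGaloisGroup K) (S T : geomTorsion (W.baseChange K) ((2 ^ k : ℕ) : ℤ)),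
    g • e S T = e (g • S) (g • T))
  (halt : ∀ T, e T T = 1) (hnondeg : ∀ T, (∀ S, e S T = 1) → T = 0)
  (inv : LocalInvariants K (2 ^ k))
  (hK : IsImaginaryQuadratic K) (hD : NumberField.discr K < -4) (ι : K →+* ℂ)
  [∀ j : ℕ, NumberField (ringClassField K ι j)] (hk : 1 ≤ k)
  (c : ℕ) (hc : Squarefree c)
  (hkol : ∀ ℓ ∈ c.primeFactors, Zhang2014.IsKolyvaginPrime (W.conductorNorm ℤ) W K 2 ℓ)
  (hkM : ∀ ℓ ∈ c.primeFactors, k + 1 ≤ Zhang2014.kolyvaginIndex W 2 ℓ)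
  (𝒯 : SelmerStructure ((W.baseChange K).torsionGaloisModule ((2 ^ k : ℕ) : ℤ)))
  (h𝒯 : ∀ v : HeightOneSpectrum (𝓞 K), 𝒯 (Sum.inr v) =
    ⨅ ℓ ∈ c.primeFactors.filter (fun ℓ : ℕ ↦ ((ℓ : ℕ) : 𝓞 K) ∈ v.asIdeal),
      ⨅ (w' : HeightOneSpectrum (𝓞 (ringClassField K ι ℓ))) (_ : w'.asIdeal.LiesOver v.asIdeal),
        letI := (adicCompletionOfLiesOver K (ringClassField K ι ℓ) v w').toAlgebra
        transverseSubgroup (GaloisRep.toLocal v ((W.baseChange K).torsionGaloisModule ((2 ^ k : ℕ) : ℤ)))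
          (w'.adicCompletion (ringClassField K ι ℓ)))
  (hperf : inv.IsPerfect) (hvan : inv.SumLocalTermEqZero) (hcomp : inv.SelmerComplement)
  {ℓ : ℕ} (hℓc : ℓ ∈ c.primeFactors)
  (hreg : ∃ (v₁ : HeightOneSpectrum (𝓞 ℚ)) (𝔓₁ : Ideal (absIntegers (𝓞 ℚ) ℚ)) (h : absoluteGaloisGroup ℚ),
    (ℓ : 𝓞 ℚ) ∈ v₁.asIdeal ∧ 𝔓₁ ∈ v₁.primesAbove ∧ IsArithFrobAt (𝓞 ℚ) h 𝔓₁ ∧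
    (∀ X : geomTorsion W ((2 ^ k : ℕ) : ℤ), h • h • X = X) ∧
    ∃ P : geomTorsion W ((2 ^ k : ℕ) : ℤ), (2 : ℤ) ^ (k - 1) • (P + h • P) ≠ 0)
  (v : HeightOneSpectrum (𝓞 K)) (hv : (ℓ : 𝓞 K) ∈ v.asIdeal)
  {τ : K ≃ₐ[ℚ] K} (hτ1 : τ ≠ 1) (hfix : τ • v = v) {s : ℤ} (hs : s = 1 ∨ s = -1)

/-! ### §1 Abstract bricks in a Lagrangian pair -/

section SignBricks

variable {L : Type*} [AddCommGroup L] {n : ℕ} (b : L →+ L →+ ZMod n)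
  (hsymm : ∀ x y, b x y = b y x)
  {Hf Htr : AddSubgroup L} (hcod : Hf ⊔ Htr = ⊤)
  (hHtr : ∀ x ∈ Htr, ∀ y ∈ Htr, b x y = 0)

include hsymm hcod hHtr in
/-- If `H_f ⊆ ℤc_s + ℤe₀` (co-cyclicity), a `t ∈ H_tr` pairing to zero with `c_s` and with `e₀` pairs to zero with
`H_f`, hence with `L = H_f + H_tr` (`H_tr` isotropic), hence is `0` (`b` non-degenerate). [folklore] -/
theorem eq_zero_of_apply_line_eq_zero (hinj : Injective b) {cs e₀ : L}
    (hco : ∀ f ∈ Hf, ∃ m : ℤ, f - m • e₀ ∈ AddSubgroup.zmultiples cs)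
    {t : L} (ht : t ∈ Htr) (hcs : b cs t = 0) (he₀ : b e₀ t = 0) : t = 0 := by
  have hf : ∀ f ∈ Hf, b f t = 0 := fun f hf ↦ by
    obtain ⟨m, hm⟩ := hco f hf
    obtain ⟨u, hu⟩ := AddSubgroup.mem_zmultiples_iff.mp hm
    have : f = u • cs + m • e₀ := by rw [hu]; abel
    rw [this, map_add, map_zsmul, map_zsmul, AddMonoidHom.add_apply, AddMonoidHom.smul_apply,
      AddMonoidHom.smul_apply, hcs, he₀, smul_zero, smul_zero, add_zero]
  have hall : ∀ x : L, b x t = 0 := fun x ↦ by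
    have hx : x ∈ Hf ⊔ Htr := by rw [hcod]; exact AddSubgroup.mem_top x
    obtain ⟨f, hf', y, hy, rfl⟩ := AddSubgroup.mem_sup.mp hx
    rw [map_add, AddMonoidHom.add_apply, hf f hf', hHtr y hy t ht, add_zero]
  apply hinj
  ext x
  rw [hsymm, hall, map_zero, AddMonoidHom.zero_apply]

include hsymm hcod hHtr in
/-- **A class of large local order in a group killing `c_s` up to `2^j`.** `H_f ⊆ ℤc_s + ℤe₀`; `S'` a group of global
classes with `loc(S') ⊆ H_tr` and `⟨c_s, 2^j • loc y⟩ = 0` for `y ∈ S'`. Then `2^j · loc(S')` lies in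
`ann_{H_tr}(c_s)`, which embeds into `ZMod n` by `⟨e₀, ·⟩` (`eq_zero_of_apply_line_eq_zero`) and is therefore CYCLIC; a
generator of the cyclic group `2^j · loc(S')` is `2^j • loc r` for some `r ∈ S'`, whence
`#loc(S') = #(loc(S') ∩ ker 2^j) · #(2^j · loc(S')) ≤ #(H_tr ∩ ker 2^j) · addOrderOf (loc r)`.
[cite: MazurRubin2004, §4.1, proof of Prop. 4.1.5] -/
theorem exists_mem_natCard_map_le_mul_addOrderOf [Finite L] (hinj : Injective b) {cs e₀ : L}
    (hco : ∀ f ∈ Hf, ∃ m : ℤ, f - m • e₀ ∈ AddSubgroup.zmultiples cs)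
    {G : Type*} [AddCommGroup G] (loc : G →+ L) (S' : AddSubgroup G) (j : ℕ)
    (hB : ∀ y ∈ S', loc y ∈ Htr) (hBcs : ∀ y ∈ S', b cs ((2 ^ j) • loc y) = 0) :
    ∃ r ∈ S', Nat.card (S'.map loc) ≤
      Nat.card ↥(Htr ⊓ (nsmulAddMonoidHom (2 ^ j) : L →+ L).ker) * addOrderOf (loc r) := by
  set δ : L →+ L := nsmulAddMonoidHom (2 ^ j) with hδ
  set B := S'.map loc with hBdef
  set C := Htr ⊓ (b cs).ker with hCdef
  -- `C ↪ ZMod n` by `⟨e₀, ·⟩`, so `C` is cyclic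
  haveI : IsAddCyclic C := by
    refine isAddCyclic_of_injective ((b e₀).comp C.subtype) fun x y hxy ↦ ?_
    apply Subtype.ext
    rw [← sub_eq_zero]
    have hx : (x : L) ∈ Htr ⊓ (b cs).ker := x.2
    have hy : (y : L) ∈ Htr ⊓ (b cs).ker := y.2
    refine eq_zero_of_apply_line_eq_zero b hsymm hcod hHtr hinj hco (Htr.sub_mem (AddSubgroup.mem_inf.mp hx).1
      (AddSubgroup.mem_inf.mp hy).1) ?_ ?_
    · rw [map_sub, (AddMonoidHom.mem_ker).mp (AddSubgroup.mem_inf.mp hx).2,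
        (AddMonoidHom.mem_ker).mp (AddSubgroup.mem_inf.mp hy).2, sub_zero]
    · rw [map_sub, sub_eq_zero]; exact hxy
  -- `δ B ≤ C`
  have hle : B.map δ ≤ C := by
    rintro _ ⟨_, ⟨y, hy, rfl⟩, rfl⟩
    exact AddSubgroup.mem_inf.mpr ⟨Htr.nsmul_mem (hB y hy) _, (AddMonoidHom.mem_ker).mpr (hBcs y hy)⟩
  haveI : IsAddCyclic ↥(B.map δ) := AddSubgroup.isAddCyclic_of_le hle
  obtain ⟨g, hg⟩ := (AddSubgroup.isAddCyclic_iff_exists_zmultiples_eq_top (B.map δ)).mp inferInstance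
  have hgmem : g ∈ B.map δ := by rw [← hg]; exact AddSubgroup.mem_zmultiples g
  obtain ⟨_, ⟨r, hr, rfl⟩, hgr⟩ := hgmem
  refine ⟨r, hr, ?_⟩
  have hcount : Nat.card B = Nat.card ↥(B ⊓ δ.ker) * Nat.card ↥(B.map δ) := card_eq_card_inf_ker_mul_card_map δ B
  have h1 : Nat.card ↥(B ⊓ δ.ker) ≤ Nat.card ↥(Htr ⊓ δ.ker) :=
    AddSubgroup.card_le_of_le (inf_le_inf_right _ (by rintro _ ⟨y, hy, rfl⟩; exact hB y hy))
  have h2 : Nat.card ↥(B.map δ) ≤ addOrderOf (loc r) := by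
    rw [← hg, Nat.card_zmultiples, ← hgr]
    exact Nat.le_of_dvd (addOrderOf_pos _) (addOrderOf_smul_dvd (2 ^ j))
  rw [hcount]
  exact Nat.mul_le_mul h1 h2

end SignBricks

/-! ### §2 In situ: a refill class of large local order -/

include hμ hadd₁ hadd₂ hgal hK hD hk hc hkol hkM h𝒯 halt hnondeg hperf hvan hℓc hreg hv hτ1 hfix hs in
/-- **A REFILL CLASS OF LARGE LOCAL ORDER.** With an `s`-eigenclass `z ∈ S` of local order `2^(k−j)` at the regular
place `v`, some `r` in the new vertex `S' = H¹_{𝓛}` has `#loc_v(S') ≤ 2·4^j · addOrderOf (loc_v r)`: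
`2^j · loc_v(S')` kills `c_s` (`X` isotropic, `2^j c_s ∈ X`), so it lies in the cyclic `ann_{𝒯_v}(c_s)`
(`exists_mem_natCard_map_le_mul_addOrderOf`), and `#(𝒯_v ∩ ker 2^j) ≤ #(Kum_v ∩ ker 2^j) ≤ 2·4^j`
(`natCard_inf_ker_le_of_pair`, p685157; `natCard_kummer_inf_ker_le`). With the cut and refill laws
(`…WalkStepLocal`, `…WalkStepRefill`) `#loc_v(S') ≥ 4^k / (2^(4j+4) · #loc_v(S))`, so at a pure-sign step
(`#loc_v(S) ≤ 2^k · O(1)`) the class `r` has local order `≥ 2^k / O_j(1)`. [cite: MazurRubin2004, §4.1, Prop. 4.1.5] -/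
theorem exists_refill_class [NeZero (2 ^ k)] [Finite (geomTorsion (W.baseChange K) ((2 ^ k : ℕ) : ℤ))]
    {j : ℕ} (hjk : j ≤ k)
    {z : galoisCohomology ((W.baseChange K).torsionGaloisModule ((2 ^ k : ℕ) : ℤ)) 1}
    (hz : z ∈ SelmerStructure.selmerGroup (Function.update (selmerF W ((2 ^ k : ℕ) : ℤ) 𝒯 (placesDividing K c))
      (Sum.inr v : Place K) ((W.baseChange K).kummerSelmerStructure ((2 ^ k : ℕ) : ℤ) (Sum.inr v : Place K)) :
      SelmerStructure ((W.baseChange K).torsionGaloisModule ((2 ^ k : ℕ) : ℤ))))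
    (hzτ : conjAct W τ ((2 ^ k : ℕ) : ℤ) z = s • z)
    (hzord : addOrderOf (galoisCohomology.localization ((W.baseChange K).torsionGaloisModule ((2 ^ k : ℕ) : ℤ))
      (Sum.inr v : Place K) 1 z) = 2 ^ (k - j)) :
    ∃ r ∈ (selmerF W ((2 ^ k : ℕ) : ℤ) 𝒯 (placesDividing K c)).selmerGroup,
      Nat.card ((selmerF W ((2 ^ k : ℕ) : ℤ) 𝒯 (placesDividing K c)).selmerGroup.map
          (galoisCohomology.localization ((W.baseChange K).torsionGaloisModule ((2 ^ k : ℕ) : ℤ))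
            (Sum.inr v : Place K) 1)) ≤
        2 * 2 ^ j * 2 ^ j * addOrderOf (galoisCohomology.localization
          ((W.baseChange K).torsionGaloisModule ((2 ^ k : ℕ) : ℤ)) (Sum.inr v : Place K) 1 r) := by
  haveI : Finite (galoisCohomology ((((W.baseChange K).torsionGaloisModule ((2 ^ k : ℕ) : ℤ))).toLocal
      (Sum.inr v : Place K)) 1) := finite_galoisCohomology_one_toLocal _ v
  haveI : ∀ w : Place K, CompactSpace (absoluteGaloisGroup (Place.Completion w)) :=
    fun w ↦ absoluteGaloisGroup_compactSpace _
  have hinv : Injective (inv (Sum.inr v)) := (hperf v).1.1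
  have hvc : v ∈ placesDividing K c := mem_placesDividing_of_mem_primeFactors hc hℓc v hv
  have hℓ := hkol ℓ hℓc
  have hkℓ : k ≤ Zhang2014.kolyvaginIndex W 2 ℓ := Nat.le_of_succ_le (hkM ℓ hℓc)
  obtain ⟨⟨cs, -, hcsord, hline⟩, e₀, -, hco⟩ := kummer_regular_eigen_at_two W K hK hk hℓ hkℓ hreg v hv hτ1 hfix hs
  set 𝓛 := selmerF W ((2 ^ k : ℕ) : ℤ) 𝒯 (placesDividing K c) with h𝓛
  set loc := galoisCohomology.localization ((W.baseChange K).torsionGaloisModule ((2 ^ k : ℕ) : ℤ))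
    (Sum.inr v : Place K) 1 with hloc
  set Rel := SelmerStructure.selmerGroup (Function.update 𝓛 (Sum.inr v : Place K) ⊤ :
    SelmerStructure ((W.baseChange K).torsionGaloisModule ((2 ^ k : ℕ) : ℤ))) with hRel
  have hz' := hz
  rw [selmerGroup_update_eq_inf_comap W k _ v] at hz'
  obtain ⟨hzRel, hzKum⟩ := AddSubgroup.mem_inf.mp hz'
  have hzKum' : loc z ∈ (W.baseChange K).kummerSelmerStructure ((2 ^ k : ℕ) : ℤ) (Sum.inr v : Place K) :=
    AddSubgroup.mem_comap.mp hzKum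
  have hzeig : loc z ∈ (W.baseChange K).kummerSelmerStructure ((2 ^ k : ℕ) : ℤ) (Sum.inr v) ⊓
      (conjActPlace W τ ((2 ^ k : ℕ) : ℤ) hfix - s • AddMonoidHom.id _).ker := by
    refine AddSubgroup.mem_inf.mpr ⟨hzKum', (AddMonoidHom.mem_ker).mpr ?_⟩
    rw [AddMonoidHom.sub_apply, AddMonoidHom.smul_apply, AddMonoidHom.id_apply, sub_eq_zero, hloc,
      conjActPlace_localization, hzτ, map_zsmul]
  have hgen : (2 ^ j) • cs ∈ AddSubgroup.zmultiples (loc z) :=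
    two_pow_nsmul_mem_zmultiples_of_addOrderOf hcsord ((hline _).mp hzeig) hjk hzord
  have hzX : loc z ∈ Rel.map loc := AddSubgroup.mem_map.mpr ⟨z, hzRel, rfl⟩
  have hgenX : (2 ^ j) • cs ∈ Rel.map loc := (AddSubgroup.zmultiples_le.mpr hzX) hgen
  have h𝓛v : 𝓛 (Sum.inr v) = 𝒯 (Sum.inr v) := by rw [h𝓛, selmerF_inr, if_pos hvc]
  have hS' : 𝓛.selmerGroup = Rel ⊓ (𝒯 (Sum.inr v)).comap loc := by
    have h := selmerGroup_update_eq_inf_comap W k 𝓛 v (𝒯 (Sum.inr v))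
    have hupd : Function.update 𝓛 (Sum.inr v : Place K) (𝒯 (Sum.inr v)) = 𝓛 := by
      rw [← h𝓛v, Function.update_eq_self]
    rw [hupd] at h
    exact h
  have hX := isotropic_map_localization_relaxed_selmerF W k e hμ hadd₁ hadd₂ hgal halt hnondeg inv hK hD ι hk c hc hkol
    hkM 𝒯 h𝒯 hperf hvan v hvc
  have hco' : ∀ f ∈ (W.baseChange K).kummerSelmerStructure ((2 ^ k : ℕ) : ℤ) (Sum.inr v : Place K), ∃ m : ℤ,
      f - m • e₀ ∈ AddSubgroup.zmultiples cs := fun f hf ↦ by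
    obtain ⟨m, hm⟩ := hco f hf
    exact ⟨m, (hline _).mp hm⟩
  obtain ⟨r, hr, hle⟩ := exists_mem_natCard_map_le_mul_addOrderOf
    (invWeilPairing (W.baseChange K) (2 ^ k) e hμ hadd₁ hadd₂ hgal inv (Sum.inr v))
    (fun x y ↦ AdditiveKoly.LagrangianSwitchAtP.invWeilPairing_symm (W.baseChange K) (2 ^ k) e hμ hadd₁ hadd₂ hgal
      halt inv (Sum.inr v) x y)
    (kummer_sup_transverse_eq_top_two W k hK hD ι hk c hc hkol hkM 𝒯 h𝒯 v hvc)
    (fun x hx y hy ↦ transverse_isotropic_two W k e hμ hadd₁ hadd₂ hgal halt hnondeg inv hK hD ι hk c hc hkol hkM 𝒯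
      h𝒯 hperf v hvc hx hy)
    (invWeilPairing_injective_of_symm W k e hμ hadd₁ hadd₂ hgal halt hnondeg inv v hinv) hco' loc 𝓛.selmerGroup j
    (fun y hy ↦ by rw [hS'] at hy; exact AddSubgroup.mem_comap.mp (AddSubgroup.mem_inf.mp hy).2)
    (fun y hy ↦ by
      rw [hS'] at hy
      have hyX : loc y ∈ Rel.map loc := AddSubgroup.mem_map.mpr ⟨y, (AddSubgroup.mem_inf.mp hy).1, rfl⟩
      rw [map_nsmul, ← AddMonoidHom.nsmul_apply, ← map_nsmul]
      exact hX _ hgenX _ hyX)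
  refine ⟨r, hr, hle.trans (Nat.mul_le_mul_right _ ?_)⟩
  exact (natCard_inf_ker_le_of_pair
    (invWeilPairing (W.baseChange K) (2 ^ k) e hμ hadd₁ hadd₂ hgal inv (Sum.inr v))
    (X11b.KummerPT.nsmul_galoisCohomology_toLocal_eq_zero (W.baseChange K) (2 ^ k) (Sum.inr v))
    (fun x y ↦ AdditiveKoly.LagrangianSwitchAtP.invWeilPairing_symm (W.baseChange K) (2 ^ k) e hμ hadd₁ hadd₂ hgal
      halt inv (Sum.inr v) x y)
    (kummer_sup_transverse_eq_top_two W k hK hD ι hk c hc hkol hkM 𝒯 h𝒯 v hvc)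
    (fun x hx y hy ↦ invWeilPairing_eq_zero_of_mem (W.baseChange K) (2 ^ k) e hμ hadd₁ hadd₂ hgal halt inv
      (Sum.inr v) hx hy)
    (fun x hx y hy ↦ transverse_isotropic_two W k e hμ hadd₁ hadd₂ hgal halt hnondeg inv hK hD ι hk c hc hkol hkM 𝒯
      h𝒯 hperf v hvc hx hy)
    (invWeilPairing_injective_of_symm W k e hμ hadd₁ hadd₂ hgal halt hnondeg inv v hinv) (2 ^ j)).trans
    (natCard_kummer_inf_ker_le W k hK hk c hkol hkM hℓc hreg v hv hτ1 hfix (2 ^ j) (by positivity))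

end Summit.BirchSwinnertonDyer.BirchSwinnertonDyer.Theorems.KolyvaginAtTwo.RegularRefill

end
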